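import Literature.Probability.LatticeModels.HarrisPartialResampling
import Literature.Probability.LatticeModels.ProdBernoulliRecolour
import HarnessLib

/-!
# The strengthened (two-copy) BK inequality and the case of equality in BK
# (Cerf–Tesio 2026, Thms. 1.5 and 1.3)

Topic `Literature/Probability/LatticeModels`; companion of `HarrisPartialResampling.lean` (same
doubled-cube formalism `PartialResampling.dbl` / `PartialResampling.mix`) and of
`ProdBernoulliBK.lean` (the tree's BK inequality `prodBernoulli_bk_local`).  Everything in this file
is PROVED; the only definitions are the printed objects `disjointTestimony` (`A ⊠ B`) and the
bookkeeping events of the printed interpolation.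

## Source, as printed

R. Cerf, P. Tesio, *The case of equality in BK*, arXiv:2607.02272 (2 Jul 2026) [CerfTesio2026].
Setting (p. 1): `Ω = {0,1}^n` with "the Bernoulli product measure `P` of parameter `p`",
`p ∈ ]0,1[`; `I ⊆ {1,…,n}` is a *witness* for `A` in `x ∈ A` if every `y` agreeing with `x` on `I`
lies in `A` (Def. 1.1); `A ∘ B` = disjoint occurrence.

* **Definition 1.4 (disjoint testimony).** "`A ⊠ B = {(x,y) ∈ A × B : ∃ I, J ⊆ {1,…,n}, I ∩ J = ∅,
  I is a witness for A in x, J is a witness for B in y}`."  (§2.1: equivalently `∃ I`, `I` a witness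
  for `A` in `x` and `Iᶜ` a witness for `B` in `y`.)
* **Theorem 1.5.** "For any pair of increasing events `A, B` in `Ω`, we have
  `P(A ∘ B) ≤ P ⊗ P(A ⊠ B)`. (1.1)"  — "This theorem immediately implies the BK inequality. Indeed,
  the disjoint testimony `A ⊠ B` is a subset of `A × B`, thus
  `P(A ∘ B) ≤ P ⊗ P(A ⊠ B) ≤ P ⊗ P(A × B) = P(A)P(B)`."  (Attributed there to Radhakrishnan–Tassion,
  arXiv:2410.23250, Remark 7 eq. (13), and to van den Berg 1985, eq. (2.6).)
* **Theorem 1.3.** "Let `p` belong to `]0,1[`, and let `A, B` be two increasing events included in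
  `Ω`. We have the equality `P(A ∘ B) = P(A)P(B)` if and only if every configuration belonging to
  `A × B` admits disjoint witnesses."
* Proof (§2.1–2.5): hybrids `x ←_k y = (y_1,…,y_k,x_{k+1},…,x_n)`,
  `A ⊠_k B = {(x,y) : ∃ I witness for A in x, Iᶜ witness for B in x ←_k y}`, so that
  `A ⊠_0 B = (A ∘ B) × Ω` and `A ⊠_n B = A ⊠ B` (2.2); at step `k`, conditionally on the other
  coordinates, the indicator `φ_k(a,b)` of `A ⊠ B` at `((x with x_k = a), (hybrid with k-th bit b))`
  is non-decreasing (increasing events) and "is not a double pivot" (Lemma 2.4: a witness pair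
  `I, Iᶜ` for `(1,1)` still works for `(1,0)` if `k ∈ I`, for `(0,1)` if `k ∉ I`), whence
  (Lemma 2.1) `P⊗P(A ⊠_k B) − P⊗P(A ⊠_{k−1} B) = p(1−p)·P⊗P(k is a symmetric disjoint pivot)
  ≥ 0` (2.11)–(2.12); equality case: Lemma 2.3 (if `A × B ⊆ A ⊠ B` there are no symmetric disjoint
  pivots) and full support of `P ⊗ P` for `p ∈ ]0,1[` (2.15).

## What is formalized

Configurations are `Set ι` (open coordinates), the measure is `prodBernoulli p` with
coordinate-dependent parameters `p : ι → [0,1]` (the printed proof is coordinatewise, so it is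
verbatim for non-constant `p`; Thm. 1.3 needs `0 < p i < 1` exactly on the coordinates the events
read).  The pair `(x, y)` is ONE configuration `ω` of the doubled cube `ι ⊕ ι` under
`prodBernoulli (dbl p)` (`x = inl ⁻¹' ω`, `y = inr ⁻¹' ω`), and the hybrid `x ←_T y` is
`PartialResampling.mix T ω` (coordinates of `T` read from the second copy).

* `disjointTestimony A B` (`A ⊠ B`, Def. 1.4) with `mem_disjointTestimony_iff_compl` (§2.1 form),
  `mem_disjointOccurrence_iff_diag` (`A □ B` is the diagonal of `A ⊠ B`),
  `disjointTestimony_subset_prod`;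
* `DisjointTestimony.dt A B T` = the event `A ⊠_T B` on the doubled cube; `real_dt_insert_eq`
  = the printed one-step IDENTITY (2.11)/(2.12) with the symmetric-pivot event `symmPivot`,
  `real_dt_mono` (monotone in `T`);
* `prodBernoulli_disjointOccurrence_le_testimony` — **Thm. 1.5** for up-sets determined by a finite
  set `F` of coordinates (any `ι`), and `…_of_finite` for finite `ι`;
* `prodBernoulli_bk_via_testimony` — the printed two-line derivation of BK from Thm. 1.5 (the
  tree's BK is `prodBernoulli_bk_local`; this is only the printed corollary, not a new route);
* `prodBernoulli_disjointOccurrence_eq_mul_of_prod_subset` — **Thm. 1.3, "if"**: if every pair of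
  `A × B` admits disjoint witnesses then `μ(A □ B) = μ(A) μ(B)`;
* `prod_subset_disjointTestimony_of_eq_mul` — **Thm. 1.3, "only if"**: if `0 < p i < 1` on `F`
  and `μ(A □ B) = μ(A) μ(B)` then `A ×ˢ B ⊆ A ⊠ B`; `prodBernoulli_disjointOccurrence_eq_mul_iff`.
* `prodBernoulli_disjointOccurrence_le_partialResample` — corollary of the interpolation: for ANY set `T`
  of resampled coordinates, `μ(A □ B) ≤ μ₂{x ∈ A, (x ←_T y) ∈ B}` (Martineau–Poudevigne–Rax 2025,
  Prop. 5.2, for the couplings "shared or independent"; `T = ∅` trivial, `T ⊇ F` = BK).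

## References

* R. Cerf, P. Tesio, *The case of equality in BK*, arXiv:2607.02272 (2026), Thms. 1.3, 1.5,
  Lemmas 2.1, 2.3, 2.4, eq. (2.12). [CerfTesio2026]
* R. R. Radhakrishnan, V. Tassion, *Strict inequalities for arm exponents in planar percolation*,
  arXiv:2410.23250, Remark 7 (13) (the inequality (1.1) for `p = 1/2`). [RadhakrishnanTassion2024]
* J. van den Berg, H. Kesten, *Inequalities with applications to percolation and reliability*,
  J. Appl. Probab. 22 (1985) 556–569 (BK). [vandenBergKestenJAP1985]
* S. Martineau, R. Poudevigne, P. Rax, *Stochastic domination and lifts of random variables in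
  percolation theory*, arXiv:2504.02427 v3 (2026), Prop. 5.2 (BK with coordinatewise coupled copies).
  [MartineauPoudevigneRax2025]
-/

noncomputable section

namespace Literature.Probability.LatticeModels

open MeasureTheory Measure Literature.Probability.Percolation PartialResampling StrongHarris

variable {ι : Type*}

/-! ### Disjoint testimony -/

/-- **Disjoint testimony** `A ⊠ B ⊆ Ω × Ω` (Cerf–Tesio Def. 1.4): the pairs `(x, y)` admitting
DISJOINT witnesses — index sets `K, L`, `K ∩ L = ∅`, with the cylinder `[x]_K ⊆ A` and
`[y]_L ⊆ B`.  Its diagonal is the disjoint occurrence `A □ B` (`mem_disjointOccurrence_iff_diag`).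
[cite: CerfTesio2026, Def. 1.4] -/
def disjointTestimony (A B : Set (Set ι)) : Set (Set ι × Set ι) :=
  {z | ∃ K L : Set ι, Disjoint K L ∧ localCylinder K z.1 ⊆ A ∧ localCylinder L z.2 ⊆ B}

@[inherit_doc] scoped infixl:70 " ⊠ " => disjointTestimony

/-- Membership in the disjoint testimony. [cite: CerfTesio2026, Def. 1.4] -/
theorem mem_disjointTestimony {A B : Set (Set ι)} {x y : Set ι} :
    (x, y) ∈ A ⊠ B ↔ ∃ K L : Set ι, Disjoint K L ∧ localCylinder K x ⊆ A ∧ localCylinder L y ⊆ B :=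
  Iff.rfl

/-- The §2.1 form of the definition: one witness `K` for `A` in `x` whose COMPLEMENT is a witness for
`B` in `y` (witnesses may be enlarged). [cite: CerfTesio2026, §2.1 (equivalent definition of A ⊠ B)] -/
theorem mem_disjointTestimony_iff_compl {A B : Set (Set ι)} {x y : Set ι} :
    (x, y) ∈ A ⊠ B ↔ ∃ K : Set ι, localCylinder K x ⊆ A ∧ localCylinder Kᶜ y ⊆ B := by
  constructor
  · rintro ⟨K, L, hKL, hA, hB⟩
    exact ⟨K, hA, (localCylinder_mono hKL.symm.subset_compl_right y).trans hB⟩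
  · rintro ⟨K, hA, hB⟩
    exact ⟨K, Kᶜ, disjoint_compl_right, hA, hB⟩

/-- `A □ B` is the diagonal of `A ⊠ B`: "`1_{A ∘ B}(x) = 1_{A ⊠ B}(x, x)`".
[cite: CerfTesio2026, §1 (definition of A ∘ B via disjoint witnesses in (u,u))] -/
theorem mem_disjointOccurrence_iff_diag {A B : Set (Set ι)} {x : Set ι} :
    x ∈ A □ B ↔ (x, x) ∈ A ⊠ B :=
  Iff.rfl

/-- `A ⊠ B ⊆ A × B` (a witnessed configuration lies in the event).
[cite: CerfTesio2026, §1 ("the disjoint testimony A ⊠ B is a subset of A × B")] -/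
theorem disjointTestimony_subset_prod (A B : Set (Set ι)) : A ⊠ B ⊆ A ×ˢ B :=
  fun z ⟨K, L, _, hA, hB⟩ =>
    ⟨hA (mem_localCylinder_self K z.1), hB (mem_localCylinder_self L z.2)⟩

/-! ### Cylinders: enlarging the base point of an up-set witness, and locality -/

/-- Two configurations agreeing on `K` have the same `K`-cylinder. [folklore] -/
theorem localCylinder_eq_of_agree {K x x' : Set ι} (h : ∀ i ∈ K, (i ∈ x ↔ i ∈ x')) :
    localCylinder K x = localCylinder K x' := by
  ext z
  exact forall₂_congr fun i hi => by rw [h i hi]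

/-- For an UP-SET `A`, a witness for `A` in `x` is a witness for `A` in every `x' ⊇ x`
(the printed "`φ_k` is non-decreasing" for increasing events). [cite: CerfTesio2026, §2.4 ("the map φ_k is non-decreasing")] -/
theorem localCylinder_subset_of_subset_of_isUpperSet {A : Set (Set ι)} (hA : IsUpperSet A)
    {K x x' : Set ι} (h : localCylinder K x ⊆ A) (hxx' : x ⊆ x') : localCylinder K x' ⊆ A := by
  classical
  intro z hz
  -- lower `z` on `K` to agree with `x`
  set z' : Set ι := {i | (i ∈ K → i ∈ x) ∧ (i ∉ K → i ∈ z)} with hz'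
  have hz'A : z' ∈ A := h fun i hi => by simp [hz', hi]
  refine hA (show z' ≤ z from fun i hi' => ?_) hz'A
  by_cases hi : i ∈ K
  · exact (hz i hi).2 (hxx' (hi'.1 hi))
  · exact hi'.2 hi

/-- The disjoint testimony of two up-sets is an up-set of `Ω × Ω`. [cite: CerfTesio2026, §2.4 ("the map φ_k is non-decreasing")] -/
theorem mem_disjointTestimony_of_subset {A B : Set (Set ι)} (hA : IsUpperSet A) (hB : IsUpperSet B)
    {x y x' y' : Set ι} (h : (x, y) ∈ A ⊠ B) (hx : x ⊆ x') (hy : y ⊆ y') : (x', y') ∈ A ⊠ B := by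
  obtain ⟨K, L, hKL, hKA, hLB⟩ := h
  exact ⟨K, L, hKL, localCylinder_subset_of_subset_of_isUpperSet hA hKA hx, localCylinder_subset_of_subset_of_isUpperSet hB hLB hy⟩

/-- Locality: if `A` is determined by `F`, whether `[x]_K ⊆ A` depends on `x` only through `x ∩ F`.
[folklore] -/
theorem localCylinder_subset_iff_of_determinedBy {A : Set (Set ι)} {F : Set ι} (hA : DeterminedBy A F)
    {K x x' : Set ι} (h : x ∩ F = x' ∩ F) : localCylinder K x ⊆ A ↔ localCylinder K x' ⊆ A := by
  classical
  -- symmetric statement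
  suffices key : ∀ {u u' : Set ι}, u ∩ F = u' ∩ F → localCylinder K u ⊆ A → localCylinder K u' ⊆ A from
    ⟨key h, key h.symm⟩
  intro u u' huu' hu z hz
  -- modify `z` on `K ∖ F` to agree with `u` there
  set z' : Set ι := {i | (i ∈ K ∧ i ∉ F → i ∈ u) ∧ (¬(i ∈ K ∧ i ∉ F) → i ∈ z)} with hz'
  have hz'cyl : z' ∈ localCylinder K u := by
    intro i hi
    by_cases hiF : i ∈ F
    · have h1 : i ∈ z ↔ i ∈ u' := hz i hi
      have h2 : i ∈ u ↔ i ∈ u' := mem_iff_of_inter_eq huu' hiF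
      have : ¬(i ∈ K ∧ i ∉ F) := fun h => h.2 hiF
      simp only [hz', Set.mem_setOf_eq, this, not_false_eq_true, forall_true_left, IsEmpty.forall_iff,
        true_and]
      rw [h1, ← h2]
    · have : i ∈ K ∧ i ∉ F := ⟨hi, hiF⟩
      simp [hz', this]
  have hz'A : z' ∈ A := hu hz'cyl
  refine ((determinedBy_iff A F).1 hA z' z ?_).1 hz'A
  ext i
  simp only [Set.mem_inter_iff, hz', Set.mem_setOf_eq]
  constructor
  · rintro ⟨⟨_, h2⟩, hiF⟩
    exact ⟨h2 fun h => h.2 hiF, hiF⟩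
  · rintro ⟨hiz, hiF⟩
    exact ⟨⟨fun h => absurd hiF h.2, fun _ => hiz⟩, hiF⟩

/-- Locality of the disjoint testimony in both arguments. [folklore] -/
theorem mem_disjointTestimony_iff_of_determinedBy {A B : Set (Set ι)} {F : Set ι} (hA : DeterminedBy A F)
    (hB : DeterminedBy B F) {x y x' y' : Set ι} (hx : x ∩ F = x' ∩ F) (hy : y ∩ F = y' ∩ F) :
    (x, y) ∈ A ⊠ B ↔ (x', y') ∈ A ⊠ B := by
  simp only [mem_disjointTestimony]
  refine exists₂_congr fun K L => and_congr_right fun _ => and_congr ?_ ?_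
  · exact localCylinder_subset_iff_of_determinedBy hA hx
  · exact localCylinder_subset_iff_of_determinedBy hB hy

namespace DisjointTestimony

/-! ### Coordinates of the doubled cube -/

section Preimages

variable (ω : Set (ι ⊕ ι)) (e : ι)

/-- Setting the first-copy bit of `e` sets `e` in the first copy. [folklore] -/
@[simp] theorem inl_preimage_insert_inl :
    Sum.inl ⁻¹' (insert (Sum.inl e) ω) = insert e (Sum.inl ⁻¹' ω : Set ι) := by
  ext i; simp

/-- Setting the second-copy bit of `e` does not change the first copy. [folklore] -/
@[simp] theorem inl_preimage_insert_inr :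
    Sum.inl ⁻¹' (insert (Sum.inr e) ω) = (Sum.inl ⁻¹' ω : Set ι) := by
  ext i; simp

/-- Clearing the first-copy bit of `e` clears `e` in the first copy. [folklore] -/
@[simp] theorem inl_preimage_sdiff_inl :
    Sum.inl ⁻¹' (ω \ {Sum.inl e}) = (Sum.inl ⁻¹' ω : Set ι) \ {e} := by
  ext i; simp

/-- Clearing the second-copy bit of `e` does not change the first copy. [folklore] -/
@[simp] theorem inl_preimage_sdiff_inr :
    Sum.inl ⁻¹' (ω \ {Sum.inr e}) = (Sum.inl ⁻¹' ω : Set ι) := by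
  ext i; simp

end Preimages

/-! ### The interpolating events `A ⊠_T B` on the doubled cube -/

/-- The event `A ⊠_T B` (printed `A ⊠_k B` with `T = {1,…,k}`): a witness for `A` in the first copy
`x` and a disjoint witness for `B` in the HYBRID `x ←_T y` (coordinates of `T` read from the second
copy). [cite: CerfTesio2026, §2.1 (the events A ⊠_k B)] -/
def dt (A B : Set (Set ι)) (T : Set ι) : Set (Set (ι ⊕ ι)) :=
  {ω | (Sum.inl ⁻¹' ω, mix T ω) ∈ A ⊠ B}

/-- Membership in `A ⊠_T B`. [cite: CerfTesio2026, §2.1] -/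
theorem mem_dt {A B : Set (Set ι)} {T : Set ι} {ω : Set (ι ⊕ ι)} :
    ω ∈ dt A B T ↔ (Sum.inl ⁻¹' ω, mix T ω) ∈ A ⊠ B := Iff.rfl

/-- `A ⊠_∅ B = (A ∘ B) × Ω`: with nothing switched the hybrid is the first copy itself.
[cite: CerfTesio2026, eq. (2.2)] -/
theorem dt_empty (A B : Set (Set ι)) :
    dt A B (∅ : Set ι) = (fun ω : Set (ι ⊕ ι) => Sum.inl ⁻¹' ω) ⁻¹' (A □ B) := by
  ext ω
  simp only [mem_dt, mix_empty, Set.mem_preimage, mem_disjointOccurrence_iff_diag]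

/-- `A ⊠_univ B = A ⊠ B` read on the pair (first copy, second copy). [cite: CerfTesio2026, eq. (2.2)] -/
theorem dt_univ (A B : Set (Set ι)) :
    dt A B (Set.univ : Set ι) = {ω | (Sum.inl ⁻¹' ω, Sum.inr ⁻¹' ω) ∈ A ⊠ B} := by
  ext ω
  simp only [mem_dt, mix_univ, Set.mem_setOf_eq]

/-- For events determined by `F`, switching the coordinates of `F` is switching everything.
[folklore] -/
theorem dt_coe_eq_dt_univ {A B : Set (Set ι)} {F : Finset ι} (hA : DeterminedBy A (↑F : Set ι))
    (hB : DeterminedBy B (↑F : Set ι)) : dt A B (↑F : Set ι) = dt A B Set.univ := by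
  ext ω
  simp only [mem_dt]
  refine mem_disjointTestimony_iff_of_determinedBy hA hB rfl ?_
  ext i
  simp only [Set.mem_inter_iff, Finset.mem_coe, mix_univ, Set.mem_preimage]
  constructor
  · rintro ⟨hi, hiF⟩; exact ⟨(mem_mix_of_mem (Finset.mem_coe.2 hiF)).1 hi, hiF⟩
  · rintro ⟨hi, hiF⟩; exact ⟨(mem_mix_of_mem (Finset.mem_coe.2 hiF)).2 hi, hiF⟩

/-- The interpolating events are cylinder events over the doubled support of `F`. [folklore] -/
theorem determinedBy_dt [DecidableEq ι] {A B : Set (Set ι)} {F : Finset ι}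
    (hA : DeterminedBy A (↑F : Set ι)) (hB : DeterminedBy B (↑F : Set ι)) (T : Set ι) :
    DeterminedBy (dt A B T) (↑(dblSupport F) : Set (ι ⊕ ι)) := by
  rw [determinedBy_iff]
  intro ω ω' h
  simp only [mem_dt]
  refine mem_disjointTestimony_iff_of_determinedBy hA hB ?_ (mix_inter_eq_of_inter_eq T h)
  ext i
  simp only [Set.mem_inter_iff, Set.mem_preimage, Finset.mem_coe]
  constructor
  · rintro ⟨hi, hiF⟩; exact ⟨(mem_iff_of_inter_eq h (Finset.mem_coe.2 (inl_mem_dblSupport hiF))).1 hi, hiF⟩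
  · rintro ⟨hi, hiF⟩; exact ⟨(mem_iff_of_inter_eq h (Finset.mem_coe.2 (inl_mem_dblSupport hiF))).2 hi, hiF⟩

/-! ### One step of the interpolation: the identity (2.11)/(2.12) -/

section Step

variable [DecidableEq ι] (p : ι → unitInterval) {A B : Set (Set ι)} {F : Finset ι}

/-- The event "`e` is a symmetric disjoint pivot for `(A, B)` in `(x, x ←_{T ∪ {e}} y)`"
(Def. 2.2): with `x = inl ⁻¹' ω` and `h` the hybrid, the pairs `(x ∪ {e}, h ∖ {e})` and
`(x ∖ {e}, h ∪ {e})` admit disjoint witnesses but `(x ∖ {e}, h ∖ {e})` does not.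
[cite: CerfTesio2026, Def. 2.2 and eq. (2.12)] -/
def symmPivot (A B : Set (Set ι)) (T : Set ι) (e : ι) : Set (Set (ι ⊕ ι)) :=
  {ω | (insert e (Sum.inl ⁻¹' ω), mix T ω \ {e}) ∈ A ⊠ B ∧
       ((Sum.inl ⁻¹' ω) \ {e}, insert e (mix T ω)) ∈ A ⊠ B ∧
       ((Sum.inl ⁻¹' ω) \ {e}, mix T ω \ {e}) ∉ A ⊠ B}

omit [DecidableEq ι] in
/-- **Lemma 2.4 ("`φ_k` is not a double pivot").** If `(x ∪ {e}, h ∪ {e})` admits disjoint witnesses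
`K, L`, then `e ∉ L` or `e ∉ K`, so `(x ∪ {e}, h ∖ {e})` or `(x ∖ {e}, h ∪ {e})` admits the same
witnesses.  No monotonicity is needed. [cite: CerfTesio2026, Lemma 2.4] -/
theorem not_doublePivot {x h : Set ι} {e : ι} (h11 : (insert e x, insert e h) ∈ A ⊠ B) :
    (insert e x, h \ {e}) ∈ A ⊠ B ∨ (x \ {e}, insert e h) ∈ A ⊠ B := by
  obtain ⟨K, L, hKL, hKA, hLB⟩ := h11
  by_cases heK : e ∈ K
  · -- `e ∉ L`: the `L`-cylinder of the hybrid does not read `e`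
    have heL : e ∉ L := fun heL => Set.disjoint_left.1 hKL heK heL
    refine Or.inl ⟨K, L, hKL, hKA, ?_⟩
    rwa [localCylinder_eq_of_agree (x' := insert e h) fun i hi => ?_]
    have hie : i ≠ e := fun hie => heL (hie ▸ hi)
    simp [hie]
  · refine Or.inr ⟨K, L, hKL, ?_, hLB⟩
    rwa [localCylinder_eq_of_agree (x' := insert e x) fun i hi => ?_]
    have hie : i ≠ e := fun hie => heK (hie ▸ hi)
    simp [hie]

/-- **The one-step identity (2.11)/(2.12).**  For up-sets `A, B` determined by `F`, a finite set
`T` of switched coordinates and `e ∉ T`, with `μ₂ = prodBernoulli (dbl p)` and `q = p e`: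
`μ₂(A ⊠_{T ∪ {e}} B) − μ₂(A ⊠_T B) = q (1 − q) · μ₂(e is a symmetric disjoint pivot)`.
Printed: "`P⊗P(A ⊠_k B) − P⊗P(A ⊠_{k−1} B) = p(1−p) P⊗P({(x,y) : k is a symmetric disjoint pivot
for (A,B) in (x, x ←_k y)})`". [cite: CerfTesio2026, eq. (2.12) (and Lemmas 2.1, 2.4)] -/
theorem real_dt_insert_eq (hAF : DeterminedBy A (↑F : Set ι)) (hBF : DeterminedBy B (↑F : Set ι))
    (hA : IsUpperSet A) (hB : IsUpperSet B) (T : Finset ι) {e : ι} (he : e ∉ T) :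
    (prodBernoulli (dbl p)).real (dt A B ↑(insert e T)) - (prodBernoulli (dbl p)).real (dt A B ↑T) =
      p e * (1 - p e) * (prodBernoulli (dbl p)).real (symmPivot A B ↑(insert e T) e) := by
  set μ := prodBernoulli (dbl p) with hμ
  set T' : Set ι := ↑(insert e T) with hT'
  set E' := dt A B T' with hE'
  set E := dt A B (↑T : Set ι) with hE
  -- the four two-bit sections of `E'`
  set U := insert (Sum.inl e) ⁻¹' E' with hU
  set D := (· \ {Sum.inl e}) ⁻¹' E' with hD
  set R := insert (Sum.inr e) ⁻¹' U with hR
  set P := (· \ {Sum.inr e}) ⁻¹' U with hP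
  set Q := insert (Sum.inr e) ⁻¹' D with hQ
  set S := (· \ {Sum.inr e}) ⁻¹' D with hS
  -- finite dependence (for the one-coordinate decompositions and measurability)
  have hE'd : DeterminedBy E' (↑(dblSupport F) : Set (ι ⊕ ι)) := determinedBy_dt hAF hBF _
  have hEd : DeterminedBy E (↑(dblSupport F) : Set (ι ⊕ ι)) := determinedBy_dt hAF hBF _
  have hUd : DeterminedBy U (↑(dblSupport F) : Set (ι ⊕ ι)) := determinedBy_preimage_insert' hE'd _
  have hDd : DeterminedBy D (↑(dblSupport F) : Set (ι ⊕ ι)) := determinedBy_preimage_sdiff' hE'd _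
  have hPd : DeterminedBy P (↑(dblSupport F) : Set (ι ⊕ ι)) := determinedBy_preimage_sdiff' hUd _
  have hQd : DeterminedBy Q (↑(dblSupport F) : Set (ι ⊕ ι)) := determinedBy_preimage_insert' hDd _
  have hSd : DeterminedBy S (↑(dblSupport F) : Set (ι ⊕ ι)) := determinedBy_preimage_sdiff' hDd _
  have hQm : MeasurableSet Q := hQd.measurableSet_of_finset
  have hSm : MeasurableSet S := hSd.measurableSet_of_finset
  -- `T` and `T'` agree off `e`; `e ∈ T'`, `e ∉ T`
  have hoff : ∀ i, i ≠ e → (i ∈ (↑T : Set ι) ↔ i ∈ T') := by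
    intro i hi
    simp only [hT', Finset.mem_coe, Finset.mem_insert, hi, false_or]
  have heT' : e ∈ T' := by simp [hT']
  have heT : e ∉ (↑T : Set ι) := fun h => he (Finset.mem_coe.1 h)
  -- explicit descriptions of the four sections, with `x = inl ⁻¹' ω`, `h = mix T' ω`
  have hRiff : ∀ ω, ω ∈ R ↔ (insert e (Sum.inl ⁻¹' ω), insert e (mix T' ω)) ∈ A ⊠ B := by
    intro ω
    simp only [hR, hU, hE', Set.mem_preimage, mem_dt, mix_11, inl_preimage_insert_inl,
      inl_preimage_insert_inr]
  have hPiff : ∀ ω, ω ∈ P ↔ (insert e (Sum.inl ⁻¹' ω), mix T' ω \ {e}) ∈ A ⊠ B := by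
    intro ω
    simp only [hP, hU, hE', Set.mem_preimage, mem_dt, mix_10_of_mem heT', inl_preimage_insert_inl,
      inl_preimage_sdiff_inr]
  have hQiff : ∀ ω, ω ∈ Q ↔ ((Sum.inl ⁻¹' ω) \ {e}, insert e (mix T' ω)) ∈ A ⊠ B := by
    intro ω
    simp only [hQ, hD, hE', Set.mem_preimage, mem_dt, mix_01_of_mem heT', inl_preimage_sdiff_inl,
      inl_preimage_insert_inr]
  have hSiff : ∀ ω, ω ∈ S ↔ ((Sum.inl ⁻¹' ω) \ {e}, mix T' ω \ {e}) ∈ A ⊠ B := by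
    intro ω
    simp only [hS, hD, hE', Set.mem_preimage, mem_dt, mix_00, inl_preimage_sdiff_inl,
      inl_preimage_sdiff_inr]
  -- the sections of the OLD event are `R` and `S` (the old hybrid reads `x_e`, as does `x`)
  have hUE : insert (Sum.inl e) ⁻¹' E = R := by
    ext ω
    rw [hRiff]
    simp only [Set.mem_preimage, hE, mem_dt, mix_insert_inl_of_not_mem heT, inl_preimage_insert_inl,
      insert_mix_congr hoff]
  have hDE : (· \ {Sum.inl e}) ⁻¹' E = S := by
    ext ω
    rw [hSiff]
    simp only [Set.mem_preimage, hE, mem_dt, mix_sdiff_inl_of_not_mem heT, inl_preimage_sdiff_inl,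
      sdiff_mix_congr hoff]
  -- Lemma 2.4: `R ⊆ P ∪ Q`; monotonicity: `P ∪ Q ⊆ R`, `S ⊆ P ∩ Q`
  have hRPQ : R = P ∪ Q := by
    ext ω
    simp only [Set.mem_union, hRiff, hPiff, hQiff]
    constructor
    · exact not_doublePivot
    · rintro (h10 | h01)
      · exact mem_disjointTestimony_of_subset hA hB h10 subset_rfl
          (Set.sdiff_subset.trans (Set.subset_insert _ _))
      · exact mem_disjointTestimony_of_subset hA hB h01
          (Set.sdiff_subset.trans (Set.subset_insert _ _)) subset_rfl
  have hSPQ : S ⊆ P ∩ Q := by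
    intro ω hω
    rw [hSiff] at hω
    simp only [Set.mem_inter_iff, hPiff, hQiff]
    exact ⟨mem_disjointTestimony_of_subset hA hB hω (Set.sdiff_subset.trans (Set.subset_insert _ _))
        subset_rfl,
      mem_disjointTestimony_of_subset hA hB hω subset_rfl
        (Set.sdiff_subset.trans (Set.subset_insert _ _))⟩
  -- the symmetric-pivot event is `(P ∩ Q) ∖ S`
  have hpiv : symmPivot A B T' e = (P ∩ Q) \ S := by
    ext ω
    simp only [symmPivot, Set.mem_setOf_eq, Set.mem_sdiff, Set.mem_inter_iff, hPiff, hQiff, hSiff, and_assoc]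
  -- measure bookkeeping: μ P + μ Q = μ R + μ (P ∩ Q), μ ((P ∩ Q) ∖ S) = μ (P ∩ Q) − μ S
  have hPQ : μ.real P + μ.real Q = μ.real R + μ.real (P ∩ Q) := by
    rw [← measureReal_union_add_inter hQm, hRPQ]
  have hdiff : μ.real ((P ∩ Q) \ S) = μ.real (P ∩ Q) - μ.real S :=
    measureReal_sdiff hSPQ hSm
  -- the one-coordinate decompositions
  have d1 : μ.real E' = p e * μ.real U + (1 - p e) * μ.real D := by
    have := real_eq_preimage_insert_add_preimage_sdiff (dbl p) (Sum.inl e) hE'd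
    simpa only [dbl_inl] using this
  have d2 : μ.real U = p e * μ.real R + (1 - p e) * μ.real P := by
    have := real_eq_preimage_insert_add_preimage_sdiff (dbl p) (Sum.inr e) hUd
    simpa only [dbl_inr] using this
  have d3 : μ.real D = p e * μ.real Q + (1 - p e) * μ.real S := by
    have := real_eq_preimage_insert_add_preimage_sdiff (dbl p) (Sum.inr e) hDd
    simpa only [dbl_inr] using this
  have d4 : μ.real E = p e * μ.real R + (1 - p e) * μ.real S := by
    have := real_eq_preimage_insert_add_preimage_sdiff (dbl p) (Sum.inl e) hEd
    simpa only [dbl_inl, hUE, hDE] using this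
  rw [hpiv, hdiff, d1, d2, d3, d4]
  linear_combination (p e : ℝ) * (1 - p e) * hPQ

/-- One more switched coordinate does not DEcrease the probability (inequality (2.3)).
[cite: CerfTesio2026, eq. (2.3)] -/
theorem real_dt_le_insert (hAF : DeterminedBy A (↑F : Set ι)) (hBF : DeterminedBy B (↑F : Set ι))
    (hA : IsUpperSet A) (hB : IsUpperSet B) (T : Finset ι) (e : ι) :
    (prodBernoulli (dbl p)).real (dt A B ↑T) ≤ (prodBernoulli (dbl p)).real (dt A B ↑(insert e T)) := by
  by_cases he : e ∈ T
  · rw [Finset.insert_eq_of_mem he]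
  · have h := real_dt_insert_eq p hAF hBF hA hB T he
    have hnn : 0 ≤ (p e : ℝ) * (1 - p e) * (prodBernoulli (dbl p)).real (symmPivot A B ↑(insert e T) e) :=
      mul_nonneg (mul_nonneg (p e).2.1 (by linarith [(p e).2.2])) measureReal_nonneg
    linarith

/-- The interpolation is monotone: `μ₂(A ⊠_T B) ≤ μ₂(A ⊠_{T'} B)` for finite `T ⊆ T'`
(the chain (2.13)). [cite: CerfTesio2026, eq. (2.13)] -/
theorem real_dt_mono (hAF : DeterminedBy A (↑F : Set ι)) (hBF : DeterminedBy B (↑F : Set ι))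
    (hA : IsUpperSet A) (hB : IsUpperSet B) {T T' : Finset ι} (hTT' : T ⊆ T') :
    (prodBernoulli (dbl p)).real (dt A B ↑T) ≤ (prodBernoulli (dbl p)).real (dt A B ↑T') := by
  -- induction on `T' ∖ T`
  suffices key : ∀ D : Finset ι, (prodBernoulli (dbl p)).real (dt A B ↑T) ≤
      (prodBernoulli (dbl p)).real (dt A B ↑(T ∪ D)) by
    have := key (T' \ T)
    rwa [Finset.union_sdiff_of_subset hTT'] at this
  intro D
  induction D using Finset.induction_on with
  | empty => simp
  | insert e D _ ih =>
    rw [Finset.union_insert]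
    exact ih.trans (real_dt_le_insert p hAF hBF hA hB _ e)

end Step

/-! ### The two ends of the interpolation -/

section Ends

variable (p : ι → unitInterval) {A B : Set (Set ι)} {F : Finset ι}

/-- Left end: `μ₂(A ⊠_∅ B) = μ(A □ B)` (first marginal). [cite: CerfTesio2026, eq. (2.2) and (2.13)] -/
theorem real_dt_empty [DecidableEq ι] (hAF : DeterminedBy A (↑F : Set ι)) (hBF : DeterminedBy B (↑F : Set ι)) :
    (prodBernoulli (dbl p)).real (dt A B ↑(∅ : Finset ι)) = (prodBernoulli p).real (A □ B) := by
  have hmeas : Measurable fun ω : Set (ι ⊕ ι) => Sum.inl ⁻¹' ω :=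
    measurable_set_iff.2 fun a => measurable_set_mem (Sum.inl a)
  -- `A □ B` is a cylinder event over `F` (it is the diagonal of `A ⊠ B`)
  have hdet : DeterminedBy (A □ B) (↑F : Set ι) := by
    rw [determinedBy_iff]
    intro ω ω' h
    simp only [mem_disjointOccurrence_iff_diag]
    exact mem_disjointTestimony_iff_of_determinedBy hAF hBF h h
  rw [Finset.coe_empty, dt_empty, ← map_measureReal_apply hmeas hdet.measurableSet_of_finset,
    prodBernoulli_dbl_map_fst]

/-- `μ₂{x ∈ A, y ∈ B} = μ(A) μ(B)` for cylinder events (independence of the two copies and the two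
marginals). [folklore] -/
theorem real_fst_inter_snd [DecidableEq ι] (hAF : DeterminedBy A (↑F : Set ι))
    (hBF : DeterminedBy B (↑F : Set ι)) :
    (prodBernoulli (dbl p)).real
        (((fun ω : Set (ι ⊕ ι) => Sum.inl ⁻¹' ω) ⁻¹' A) ∩ ((fun ω : Set (ι ⊕ ι) => Sum.inr ⁻¹' ω) ⁻¹' B)) =
      (prodBernoulli p).real A * (prodBernoulli p).real B := by
  set X₁ : Set (Set (ι ⊕ ι)) := (fun ω => Sum.inl ⁻¹' ω) ⁻¹' A with hX₁
  set X₂ : Set (Set (ι ⊕ ι)) := (fun ω => Sum.inr ⁻¹' ω) ⁻¹' B with hX₂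
  have hm₁ : Measurable fun ω : Set (ι ⊕ ι) => Sum.inl ⁻¹' ω :=
    measurable_set_iff.2 fun a => measurable_set_mem (Sum.inl a)
  have hm₂ : Measurable fun ω : Set (ι ⊕ ι) => Sum.inr ⁻¹' ω :=
    measurable_set_iff.2 fun a => measurable_set_mem (Sum.inr a)
  have hAm : MeasurableSet A := hAF.measurableSet_of_finset
  have hBm : MeasurableSet B := hBF.measurableSet_of_finset
  have e₁ : (prodBernoulli (dbl p)).real X₁ = (prodBernoulli p).real A := by
    rw [hX₁, ← map_measureReal_apply hm₁ hAm, prodBernoulli_dbl_map_fst]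
  have e₂ : (prodBernoulli (dbl p)).real X₂ = (prodBernoulli p).real B := by
    rw [hX₂, ← map_measureReal_apply hm₂ hBm, prodBernoulli_dbl_map_snd]
  have hd₁ : DeterminedBy X₁ (↑(F.image (Sum.inl : ι → ι ⊕ ι)) : Set (ι ⊕ ι)) := by
    rw [determinedBy_iff]
    intro ω ω' h
    simp only [hX₁, Set.mem_preimage]
    refine (determinedBy_iff _ _).1 hAF _ _ ?_
    ext i
    simp only [Set.mem_inter_iff, Set.mem_preimage, Finset.mem_coe]
    constructor
    · rintro ⟨hi, hiF⟩; exact ⟨(mem_iff_of_inter_eq h (by simp [hiF])).1 hi, hiF⟩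
    · rintro ⟨hi, hiF⟩; exact ⟨(mem_iff_of_inter_eq h (by simp [hiF])).2 hi, hiF⟩
  have hd₂ : DeterminedBy X₂ (↑(F.image (Sum.inr : ι → ι ⊕ ι)) : Set (ι ⊕ ι)) := by
    rw [determinedBy_iff]
    intro ω ω' h
    simp only [hX₂, Set.mem_preimage]
    refine (determinedBy_iff _ _).1 hBF _ _ ?_
    ext i
    simp only [Set.mem_inter_iff, Set.mem_preimage, Finset.mem_coe]
    constructor
    · rintro ⟨hi, hiF⟩; exact ⟨(mem_iff_of_inter_eq h (by simp [hiF])).1 hi, hiF⟩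
    · rintro ⟨hi, hiF⟩; exact ⟨(mem_iff_of_inter_eq h (by simp [hiF])).2 hi, hiF⟩
  have hdisj : Disjoint (F.image (Sum.inl : ι → ι ⊕ ι)) (F.image (Sum.inr : ι → ι ⊕ ι)) := by
    rw [Finset.disjoint_left]
    intro j hj hj'
    simp only [Finset.mem_image] at hj hj'
    obtain ⟨i, _, rfl⟩ := hj
    obtain ⟨i', _, hi'⟩ := hj'
    exact Sum.inr_ne_inl hi'
  rw [prodBernoulli_real_inter_of_determinedBy_disjoint (dbl p) hdisj hd₁ hd₂
    hd₁.measurableSet_of_finset hd₂.measurableSet_of_finset, e₁, e₂]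

/-- Right end, upper bound: `μ₂{(x,y) ∈ A ⊠ B} ≤ μ₂{x ∈ A, y ∈ B} = μ(A) μ(B)` (the two copies are
independent). [cite: CerfTesio2026, §1 ("P⊗P(A ⊠ B) ≤ P⊗P(A × B) = P(A)P(B)")] -/
theorem real_testimony_le_mul [DecidableEq ι] (hAF : DeterminedBy A (↑F : Set ι))
    (hBF : DeterminedBy B (↑F : Set ι)) :
    (prodBernoulli (dbl p)).real {ω : Set (ι ⊕ ι) | (Sum.inl ⁻¹' ω, Sum.inr ⁻¹' ω) ∈ A ⊠ B} ≤
      (prodBernoulli p).real A * (prodBernoulli p).real B := by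
  rw [← real_fst_inter_snd p hAF hBF]
  exact measureReal_mono fun ω hω => disjointTestimony_subset_prod A B hω

end Ends

end DisjointTestimony

open DisjointTestimony

/-! ### Theorem 1.5: the strengthened BK inequality -/

/-- **Strengthened BK inequality (Cerf–Tesio Thm. 1.5; Radhakrishnan–Tassion (13)), cylinder
events.**  For up-sets `A, B ⊆ Set ι` determined by a finite set `F` of coordinates and
`μ = prodBernoulli p`, `μ₂ = prodBernoulli (dbl p)` (a configuration `x` and an independent copy
`y`):  `μ(A □ B) ≤ μ₂{(x, y) ∈ A ⊠ B}` — "`P(A ∘ B) ≤ P ⊗ P(A ⊠ B)`".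
[cite: CerfTesio2026, Thm. 1.5] -/
theorem prodBernoulli_disjointOccurrence_le_testimony (p : ι → unitInterval) (F : Finset ι)
    {A B : Set (Set ι)} (hAF : DeterminedBy A (↑F : Set ι)) (hBF : DeterminedBy B (↑F : Set ι))
    (hA : IsUpperSet A) (hB : IsUpperSet B) :
    (prodBernoulli p).real (A □ B) ≤
      (prodBernoulli (dbl p)).real {ω : Set (ι ⊕ ι) | (Sum.inl ⁻¹' ω, Sum.inr ⁻¹' ω) ∈ A ⊠ B} := by
  classical
  rw [← real_dt_empty p hAF hBF, ← dt_univ, ← dt_coe_eq_dt_univ hAF hBF]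
  exact real_dt_mono p hAF hBF hA hB (Finset.empty_subset F)

/-- **Strengthened BK inequality (Cerf–Tesio Thm. 1.5), finite index type** (every event is a
cylinder event): for up-sets `A, B`, `μ(A □ B) ≤ μ₂{(x, y) ∈ A ⊠ B}`.
[cite: CerfTesio2026, Thm. 1.5] -/
theorem prodBernoulli_disjointOccurrence_le_testimony_of_finite [Finite ι] (p : ι → unitInterval)
    {A B : Set (Set ι)} (hA : IsUpperSet A) (hB : IsUpperSet B) :
    (prodBernoulli p).real (A □ B) ≤
      (prodBernoulli (dbl p)).real {ω : Set (ι ⊕ ι) | (Sum.inl ⁻¹' ω, Sum.inr ⁻¹' ω) ∈ A ⊠ B} := by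
  classical
  haveI := Fintype.ofFinite ι
  have hall : ∀ X : Set (Set ι), DeterminedBy X (↑(Finset.univ : Finset ι) : Set ι) := fun X => by
    rw [determinedBy_iff]; intro ω ω' h; simp only [Finset.coe_univ, Set.inter_univ] at h; rw [h]
  exact prodBernoulli_disjointOccurrence_le_testimony p Finset.univ (hall A) (hall B) hA hB

/-- **BK from Thm. 1.5** (the printed two-line corollary): `μ(A □ B) ≤ μ₂(A ⊠ B) ≤ μ₂(A × B)
= μ(A) μ(B)`.  The tree's BK inequality is `prodBernoulli_bk_local` (van den Berg–Kesten 1985);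
this is only the printed derivation from the strengthened form.
[cite: CerfTesio2026, §1 (Thm. 1.5 "immediately implies the BK inequality")] -/
theorem prodBernoulli_bk_via_testimony (p : ι → unitInterval) (F : Finset ι)
    {A B : Set (Set ι)} (hAF : DeterminedBy A (↑F : Set ι)) (hBF : DeterminedBy B (↑F : Set ι))
    (hA : IsUpperSet A) (hB : IsUpperSet B) :
    (prodBernoulli p).real (A □ B) ≤ (prodBernoulli p).real A * (prodBernoulli p).real B := by
  classical
  exact (prodBernoulli_disjointOccurrence_le_testimony p F hAF hBF hA hB).trans
    (real_testimony_le_mul p hAF hBF)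

/-! ### Theorem 1.3: the case of equality -/

/-- **Lemma 2.3.** If every pair of `A × B` admits disjoint witnesses then there are no symmetric
disjoint pivots. [cite: CerfTesio2026, Lemma 2.3] -/
theorem DisjointTestimony.symmPivot_eq_empty_of_prod_subset {A B : Set (Set ι)} (h : A ×ˢ B ⊆ A ⊠ B)
    (T : Set ι) (e : ι) : symmPivot A B T e = ∅ := by
  ext ω
  simp only [symmPivot, Set.mem_setOf_eq, Set.mem_empty_iff_false, iff_false, not_and, not_not]
  intro h10 h01
  refine h (Set.mk_mem_prod ?_ ?_)
  · exact (disjointTestimony_subset_prod A B h01).1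
  · exact (disjointTestimony_subset_prod A B h10).2

/-- **Thm. 1.3, "if".**  If every pair `(u, v) ∈ A × B` admits disjoint witnesses for `A` and `B`
(`A ×ˢ B ⊆ A ⊠ B`), then there is EQUALITY in BK: `μ(A □ B) = μ(A) μ(B)` — for up-sets `A, B`
determined by a finite `F`, any parameters `p`. [cite: CerfTesio2026, Thm. 1.3 (converse implication, §2.5)] -/
theorem prodBernoulli_disjointOccurrence_eq_mul_of_prod_subset (p : ι → unitInterval) (F : Finset ι)
    {A B : Set (Set ι)} (hAF : DeterminedBy A (↑F : Set ι)) (hBF : DeterminedBy B (↑F : Set ι))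
    (hA : IsUpperSet A) (hB : IsUpperSet B) (h : A ×ˢ B ⊆ A ⊠ B) :
    (prodBernoulli p).real (A □ B) = (prodBernoulli p).real A * (prodBernoulli p).real B := by
  classical
  set μ₂ := prodBernoulli (dbl p) with hμ₂
  -- every step of the interpolation is an equality
  have hstep : ∀ D : Finset ι, μ₂.real (dt A B ↑(∅ : Finset ι)) = μ₂.real (dt A B ↑((∅ : Finset ι) ∪ D)) := by
    intro D
    induction D using Finset.induction_on with
    | empty => simp
    | insert e D heD ih =>
      rw [Finset.union_insert, ih]
      by_cases he : e ∈ (∅ : Finset ι) ∪ D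
      · rw [Finset.insert_eq_of_mem he]
      · have := real_dt_insert_eq p hAF hBF hA hB _ he
        rw [symmPivot_eq_empty_of_prod_subset h, measureReal_empty, mul_zero] at this
        linarith
  have hF := hstep F
  rw [Finset.empty_union, real_dt_empty p hAF hBF, dt_coe_eq_dt_univ hAF hBF, dt_univ] at hF
  rw [hF]
  -- and `A ⊠ B = A × B`
  refine le_antisymm (real_testimony_le_mul p hAF hBF) ?_
  rw [← real_fst_inter_snd p hAF hBF]
  exact measureReal_mono fun ω hω => h (Set.mk_mem_prod hω.1 hω.2)

/-- **Thm. 1.3, "only if".**  If `0 < p i < 1` for the coordinates `i ∈ F` read by the up-sets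
`A, B` and `μ(A □ B) = μ(A) μ(B)`, then every pair of `A × B` admits disjoint witnesses
(`A ×ˢ B ⊆ A ⊠ B`).  Printed for constant `p ∈ ]0,1[`: "the product measure `P ⊗ P` has full support
on `Ω²`. Hence the equality (2.15) implies that `(A × B) ∖ (A ⊠ B)` is void".
[cite: CerfTesio2026, Thm. 1.3 (direct implication, §2.5 eq. (2.13)–(2.15))] -/
theorem prod_subset_disjointTestimony_of_eq_mul (p : ι → unitInterval) (F : Finset ι)
    {A B : Set (Set ι)} (hAF : DeterminedBy A (↑F : Set ι)) (hBF : DeterminedBy B (↑F : Set ι))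
    (hA : IsUpperSet A) (hB : IsUpperSet B)
    (hp : ∀ i ∈ F, 0 < (p i : ℝ) ∧ (p i : ℝ) < 1)
    (heq : (prodBernoulli p).real (A □ B) = (prodBernoulli p).real A * (prodBernoulli p).real B) :
    A ×ˢ B ⊆ A ⊠ B := by
  classical
  set μ₂ := prodBernoulli (dbl p) with hμ₂
  set X : Set (Set (ι ⊕ ι)) :=
    (((fun ω : Set (ι ⊕ ι) => Sum.inl ⁻¹' ω) ⁻¹' A) ∩ ((fun ω : Set (ι ⊕ ι) => Sum.inr ⁻¹' ω) ⁻¹' B))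
    with hX
  set Tm : Set (Set (ι ⊕ ι)) := {ω | (Sum.inl ⁻¹' ω, Sum.inr ⁻¹' ω) ∈ A ⊠ B} with hTm
  -- the chain (2.13) collapses: μ₂(X ∖ Tm) = 0
  have h1 : (prodBernoulli p).real (A □ B) ≤ μ₂.real Tm :=
    prodBernoulli_disjointOccurrence_le_testimony p F hAF hBF hA hB
  have h2 : μ₂.real X = (prodBernoulli p).real A * (prodBernoulli p).real B :=
    real_fst_inter_snd p hAF hBF
  have hTX : Tm ⊆ X := fun ω hω => disjointTestimony_subset_prod A B hω
  have hTd : DeterminedBy Tm (↑(dblSupport F) : Set (ι ⊕ ι)) := by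
    have := determinedBy_dt hAF hBF (Set.univ : Set ι)
    rwa [dt_univ] at this
  have hTmeas : MeasurableSet Tm := hTd.measurableSet_of_finset
  have hzero : μ₂.real (X \ Tm) = 0 := by
    rw [measureReal_sdiff hTX hTmeas]
    linarith [measureReal_mono (μ := μ₂) hTX]
  -- full support: a nonempty cylinder set over `dblSupport F` has positive measure
  rintro ⟨u, v⟩ ⟨hu, hv⟩
  by_contra hnot
  -- the configuration of the doubled cube with first copy `u` and second copy `v`
  set ω₀ : Set (ι ⊕ ι) := {j | Sum.elim (· ∈ u) (· ∈ v) j} with hω₀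
  have hω₀l : Sum.inl ⁻¹' ω₀ = u := by ext i; simp [hω₀]
  have hω₀r : Sum.inr ⁻¹' ω₀ = v := by ext i; simp [hω₀]
  have hω₀X : ω₀ ∈ X \ Tm := by
    refine ⟨⟨?_, ?_⟩, ?_⟩
    · simpa [hX, hω₀l] using hu
    · simpa [hX, hω₀r] using hv
    · simpa [hTm, hω₀l, hω₀r] using hnot
  -- `X ∖ Tm` is determined by `dblSupport F`, so it contains the cylinder of `ω₀`
  have hXd : DeterminedBy X (↑(dblSupport F) : Set (ι ⊕ ι)) := by
    rw [determinedBy_iff]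
    intro ω ω' h
    simp only [hX, Set.mem_inter_iff, Set.mem_preimage]
    have hl : Sum.inl ⁻¹' ω ∩ ↑F = Sum.inl ⁻¹' ω' ∩ ↑F := by
      ext i
      simp only [Set.mem_inter_iff, Set.mem_preimage, Finset.mem_coe]
      constructor
      · rintro ⟨hi, hiF⟩; exact ⟨(mem_iff_of_inter_eq h (Finset.mem_coe.2 (inl_mem_dblSupport hiF))).1 hi, hiF⟩
      · rintro ⟨hi, hiF⟩; exact ⟨(mem_iff_of_inter_eq h (Finset.mem_coe.2 (inl_mem_dblSupport hiF))).2 hi, hiF⟩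
    have hr : Sum.inr ⁻¹' ω ∩ ↑F = Sum.inr ⁻¹' ω' ∩ ↑F := by
      ext i
      simp only [Set.mem_inter_iff, Set.mem_preimage, Finset.mem_coe]
      constructor
      · rintro ⟨hi, hiF⟩; exact ⟨(mem_iff_of_inter_eq h (Finset.mem_coe.2 (inr_mem_dblSupport hiF))).1 hi, hiF⟩
      · rintro ⟨hi, hiF⟩; exact ⟨(mem_iff_of_inter_eq h (Finset.mem_coe.2 (inr_mem_dblSupport hiF))).2 hi, hiF⟩
    rw [(determinedBy_iff _ _).1 hAF _ _ hl, (determinedBy_iff _ _).1 hBF _ _ hr]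
  have hcyl : localCylinder (↑(dblSupport F) : Set (ι ⊕ ι)) ω₀ ⊆ X \ Tm := by
    intro ω hω
    have hagree : ω ∩ ↑(dblSupport F) = ω₀ ∩ ↑(dblSupport F) := by
      ext j
      simp only [Set.mem_inter_iff, Finset.mem_coe]
      constructor
      · rintro ⟨hj, hjF⟩; exact ⟨(hω j hjF).1 hj, hjF⟩
      · rintro ⟨hj, hjF⟩; exact ⟨(hω j hjF).2 hj, hjF⟩
    have hXiff := (determinedBy_iff _ _).1 hXd _ _ hagree
    have hTiff := (determinedBy_iff _ _).1 hTd _ _ hagree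
    exact ⟨hXiff.2 hω₀X.1, fun h => hω₀X.2 (hTiff.1 h)⟩
  -- its measure is at least `δ ^ #(dblSupport F) > 0`
  obtain ⟨δ, hδ0, hδ⟩ : ∃ δ : ℝ, 0 < δ ∧ ∀ i ∈ F, δ ≤ (p i : ℝ) ∧ δ ≤ 1 - (p i : ℝ) := by
    by_cases hF : F.Nonempty
    · obtain ⟨i₀, hi₀, hmin⟩ := F.exists_min_image (fun i => min (p i : ℝ) (1 - p i)) hF
      refine ⟨min (p i₀ : ℝ) (1 - p i₀), lt_min (hp i₀ hi₀).1 (by linarith [(hp i₀ hi₀).2]), ?_⟩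
      intro i hi
      exact ⟨(hmin i hi).trans (min_le_left _ _), (hmin i hi).trans (min_le_right _ _)⟩
    · exact ⟨1, one_pos, fun i hi => absurd ⟨i, hi⟩ hF⟩
  have hpos : 0 < μ₂.real (localCylinder (↑(dblSupport F) : Set (ι ⊕ ι)) ω₀) := by
    refine lt_of_lt_of_le (pow_pos hδ0 _) (le_prodBernoulli_real_localCylinder_of_forall (dbl p)
      (dblSupport F) ω₀ hδ0.le ?_ ?_)
    · intro j hj
      rcases Finset.mem_union.1 hj with hj | hj
      · obtain ⟨i, hi, rfl⟩ := Finset.mem_image.1 hj; simpa using (hδ i hi).1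
      · obtain ⟨i, hi, rfl⟩ := Finset.mem_image.1 hj; simpa using (hδ i hi).1
    · intro j hj
      rcases Finset.mem_union.1 hj with hj | hj
      · obtain ⟨i, hi, rfl⟩ := Finset.mem_image.1 hj; simpa using (hδ i hi).2
      · obtain ⟨i, hi, rfl⟩ := Finset.mem_image.1 hj; simpa using (hδ i hi).2
  have := measureReal_mono (μ := μ₂) hcyl
  linarith

/-- **The case of equality in BK (Cerf–Tesio Thm. 1.3).**  For up-sets `A, B` determined by a
finite set `F` of coordinates with `0 < p i < 1` on `F`:
`μ(A □ B) = μ(A) μ(B)` iff every pair `(u, v) ∈ A × B` admits disjoint witnesses for `A` and `B`.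
[cite: CerfTesio2026, Thm. 1.3] -/
theorem prodBernoulli_disjointOccurrence_eq_mul_iff (p : ι → unitInterval) (F : Finset ι)
    {A B : Set (Set ι)} (hAF : DeterminedBy A (↑F : Set ι)) (hBF : DeterminedBy B (↑F : Set ι))
    (hA : IsUpperSet A) (hB : IsUpperSet B) (hp : ∀ i ∈ F, 0 < (p i : ℝ) ∧ (p i : ℝ) < 1) :
    (prodBernoulli p).real (A □ B) = (prodBernoulli p).real A * (prodBernoulli p).real B ↔
      A ×ˢ B ⊆ A ⊠ B :=
  ⟨prod_subset_disjointTestimony_of_eq_mul p F hAF hBF hA hB hp,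
    prodBernoulli_disjointOccurrence_eq_mul_of_prod_subset p F hAF hBF hA hB⟩

/-! ### Corollary: disjoint occurrence is bounded by joint occurrence on PARTIALLY resampled copies
(Martineau–Poudevigne–Rax 2025, Prop. 5.2, for the couplings "coordinate shared or independent") -/

/-- Locality of the interpolating event in the switched set: only `T ∩ F` matters for events
determined by `F`. [folklore] -/
theorem DisjointTestimony.dt_eq_dt_inter {A B : Set (Set ι)} {F : Finset ι}
    (hA : DeterminedBy A (↑F : Set ι)) (hB : DeterminedBy B (↑F : Set ι)) (T : Set ι) :
    dt A B T = dt A B (T ∩ ↑F) := by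
  ext ω
  simp only [mem_dt]
  refine mem_disjointTestimony_iff_of_determinedBy hA hB rfl ?_
  ext i
  simp only [Set.mem_inter_iff, Finset.mem_coe, mem_mix]
  constructor
  · rintro ⟨⟨h1, h2⟩, hiF⟩
    exact ⟨⟨fun hT => h1 hT.1, fun hT => h2 fun hT' => hT ⟨hT', hiF⟩⟩, hiF⟩
  · rintro ⟨⟨h1, h2⟩, hiF⟩
    exact ⟨⟨fun hT => h1 ⟨hT, hiF⟩, fun hT => h2 fun hT' => hT hT'.1⟩, hiF⟩

/-- **BK with partial resampling** (Martineau–Poudevigne–Rax Prop. 5.2 in the case where each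
coordinate pair `ρ_i` is either "shared" (`i ∉ T`: both copies read `x_i`) or "independent"
(`i ∈ T`)): for up-sets `A, B` determined by a finite `F` and ANY set `T` of resampled coordinates,
`μ(A □ B) ≤ μ₂{x ∈ A and (x ←_T y) ∈ B}` — disjoint occurrence in one configuration is at most joint
occurrence when `B` is read on a copy whose `T`-coordinates are fresh.  `T = ∅` is the trivial
`A □ B ⊆ A ∩ B`, `T ⊇ F` is BK; printed: "Let 𝐏 be a probability measure on `{0,1}^{C×{1,2}}` of the
form `⊗_{i∈C} ρ_i`, where `ρ_i` is a probability measure on `{0,1}²` such that both its marginals are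
Bernoulli of parameter at least `p_i`. Then, we have `P(E₁ ∘ E₂) ≤ 𝐏(E₁ × E₂)`."  Here via
Cerf–Tesio's interpolation: `μ(A □ B) = μ₂(A ⊠_∅ B) ≤ μ₂(A ⊠_{T∩F} B) ≤ μ₂{x ∈ A, x ←_T y ∈ B}`.
[cite: MartineauPoudevigneRax2025, Prop. 5.2 (special case ρ_i ∈ {diagonal, product})] -/
theorem prodBernoulli_disjointOccurrence_le_partialResample (p : ι → unitInterval) (F : Finset ι)
    {A B : Set (Set ι)} (hAF : DeterminedBy A (↑F : Set ι)) (hBF : DeterminedBy B (↑F : Set ι))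
    (hA : IsUpperSet A) (hB : IsUpperSet B) (T : Set ι) :
    (prodBernoulli p).real (A □ B) ≤
      (prodBernoulli (dbl p)).real {ω : Set (ι ⊕ ι) | Sum.inl ⁻¹' ω ∈ A ∧ mix T ω ∈ B} := by
  classical
  -- the switched set may be replaced by the finite set `T ∩ F`
  set T' : Finset ι := F.filter (· ∈ T) with hT'
  have hTT' : T ∩ ↑F = (↑T' : Set ι) := by
    ext i
    simp only [hT', Set.mem_inter_iff, Finset.mem_coe, Finset.mem_filter]
    exact and_comm
  have h1 : (prodBernoulli p).real (A □ B) ≤ (prodBernoulli (dbl p)).real (dt A B ↑T') := by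
    rw [← real_dt_empty p hAF hBF]
    exact real_dt_mono p hAF hBF hA hB (Finset.empty_subset T')
  refine h1.trans (measureReal_mono fun ω hω => ?_)
  rw [← hTT', ← DisjointTestimony.dt_eq_dt_inter hAF hBF T, mem_dt] at hω
  exact disjointTestimony_subset_prod A B hω

end Literature.Probability.LatticeModels
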